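import Literature.AlgebraicGeometry.Frobenioids.DivSlimRemarkProofs
import HarnessLib

/-!
# Frobenioids I, Definition 4.5 (iv) "Div-slim" (`PreFrobenioidData.IsDivSlim`): the universal closure of
# the PREDICATE is false — kernel `¬ ∀` (FACT-LIST row F-2341, schema / R5)

Mochizuki, *The geometry of Frobenioids I: the general theory*, Kyushu J. Math. **62** (2008) 293–400,
Definition 4.5 (iv), kurims text p. 86: "`D` is Div-slim [relative to `Φ`] if … `Aut(D_A → D) → Aut(D_A → Mon)`
is injective" [cite: MochizukiFrdI2008, Def. 4.5 (iv) p.86]; Remark 4.12.1 p. 95 / Remark 4.11.2 p. 94: the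
base of Example 3.10 "fails to be Div-slim" [cite: MochizukiFrdI2008, Rem. 4.12.1 p.95].

PROOF-ONLY companion of `DivisorMonoidCategoryTheoreticityDefs.lean` (statement file, seat abc-iut-L1-t3;
this file: cell abc-iut, F fact-proving wave, seat abc-iut-f-036, FACT-LIST row **F-2341**
`PreFrobenioidData.IsDivSlim` [structure], [FrdI] Def. 4.5 (iv) p. 86). The row is a DEFINITION — a
predicate on the operations `S : PreFrobenioidData C D` — not a published claim: its universal closure
"every base category is Div-slim relative to every divisor monoid" is FALSE, and print says so (Rem. 4.11.2,
Rem. 4.12.1, Ex. 4.7 (i)). This file records the kernel `¬ ∀` (`PreFrobenioidData.not_forall_isDivSlim`), by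
NAME from seat abc-iut-L1-t8's landed `Rmk4121.not_isDivSlim` (the base `B(G)` of Example 3.10, `G`
non-trivial, identity pull-backs), so that the row is read "schema — NAMED instances only" (cell rule R5).
The NAMED instances the tree proves (cited, not restated): `arithFrobenioidOps_isDivSlim` and
`arithFrobenioid_perfection_isDivSlim` (Thm. 6.4 (i), arithmetic Frobenioids and their perfections),
`Ex47ii.isDivSlim` (Ex. 4.7 (ii)), `isDivSlim_ofFunctor_rlf` (realification), the transports
`PreFrobenioidData.isDivSlim_of_isSlim` (Def. 4.5 (iv) "slim ⇒ Div-slim") and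
`PreFrobenioidData.IsDivSlim.of_injective_hom`. No definitions; no statement of the paper is touched;
nothing here bears on [IUTchIII] Cor. 3.12 (a FACT row is an assumption label, not an endorsement).
-/

namespace Literature.AlgebraicGeometry.Frobenioids

open CategoryTheory

namespace PreFrobenioidData

/-- **F-2341 (FACT-LIST), schema negative.** The universal closure of Definition 4.5 (iv)
`PreFrobenioidData.IsDivSlim` — "every `D` is Div-slim relative to every `Φ`" — is false: the one-object base
`B(G)` of Example 3.10 for the non-trivial group `G = ℤ` (written multiplicatively), relative to the monoid
`ℤ_{≥0}` with identity pull-backs, is not Div-slim (Rem. 4.12.1 / Rem. 4.11.2; seat abc-iut-L1-t8's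
`Rmk4121.not_isDivSlim`). Stated at universe level `0`, where the witness lives; Div-slimness is a
HYPOTHESIS to be verified per named base (R5), never a fact. [cite: MochizukiFrdI2008, Rem. 4.12.1 p.95] -/
theorem not_forall_isDivSlim :
    ¬ ∀ (C : Type) [Category.{0} C] (D : Type) [Category.{0} D] (S : PreFrobenioidData.{0} C D),
      S.IsDivSlim :=
  fun h => Rmk4121.not_isDivSlim (Multiplicative ℤ) (h _ _ (Ex310.data (Multiplicative ℤ)))

end PreFrobenioidData

end Literature.AlgebraicGeometry.Frobenioids
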